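import Summits.QuantumFields.YangMills.Theorems.FluctuationComparisonRegPrIntLS2BetaCubeInterpolant
import Summits.QuantumFields.YangMills.Theorems.FluctuationComparisonRegPrIntLS2BetaResidualGaugeRooted
import Literature.MathematicalPhysics.QuantumFieldTheory.Balaban1983to89.T3PrintedRegularOrbits
import Literature.MathematicalPhysics.QuantumFieldTheory.Balaban1983to89.B9B8KnitAveragingClosenessAtCorner
import Literature.MathematicalPhysics.QuantumFieldTheory.Balaban1983to89.BlockAveragingEMLProp2
import HarnessLib

/-!
# S2β · (RES-u.7) «THE LIPSCHITZ LIFT EXISTS» — every coarse gauge transformation `t` on `T_J` with bond gradients `dist1(t B₊·(t B₋)⁻¹) ≤ τ ≤ 1∕8` has a fine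
# lift `û` on run `K`'s finest lattice with `û↓ = t` and PER-FINE-BOND gradient `dist1(û b₊·(û b₋)⁻¹) ≤ 2π·τ·(L⁻¹)^{K−J}` (`C_lift = 2π`, window `1∕8`)

Cell `ym3-torus` (YM ladder rung R3 = continuum `SU(2)` Yang–Mills on the three-torus at fixed lattice data — a RUNG: NOT d = 4, NOT infinite volume,
NOT a mass gap, NOT Clay).  Width seat «width 21» `ym3-torus-px21` (gen 26), FREE px helper on crux `stmt-QuantumFields-20520`
(`…Theses.UnitScaleTilt.FluctuationComparisonRegPrIntL`), LINE g18-1 S2β; pen (RES-u.7) (desk WORD №709 «MINE (RES-u.7)», architect px17 g23 «E_J-FACE» exit (a),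
★★OWNER RULING №131 «px21 g26 keeps (RES-u.7)»).  WHY IT EXISTS (my COUNT «E_J-FACE», 2026-09-01T01:58Z): at the BLOCK-CONSTANT lift `ǔ = liftTransfTo t`
(lit ✓`descTransf_liftTransfTo`) the fine bonds crossing a top face carry the whole coarse jump — `dist1 ≥ τ′ − 4σ = O(window)` — so ✓p839973's `E_J`, the
(REG)@representative sup letters and (RES-u.6)'s oscillation, read at the moved triple, are `O(window)` and NOT `O(window·L^{−(K−J)})`; spreading the jump
evenly over the `L^{K−J}` fine steps between neighbouring centres repairs every one of them at once.  CONSUMERS (shape fixed with them BEFORE typing; the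
∃-export below is their hypothesis text VERBATIM): ✓p840017 px16 g24 `…S2BetaBodyRebaseLift.body_triple_iff_of_descTransf_eq (û) (hû : descTransf F J K hJK û = t)`
(the lift-independent door: ANY lift with `û↓ = t` re-bases the body triple), w5 g29 (RES-u.7σ) `…S2BetaSmoothResidualCopy.exists_smoothResidualCopy (hg) (hlift)`
(`hlift` = this export at `t := g↓`; its §6 `bondGrad_descTransf_le_of_descent` inhabits `hgrad`; DOCK TWIN by kernel rc 0, bus 02:21:40Z), ✓p840003 w5 g29
(RES-u.4′) `…S2BetaLiftGradientFeed` and ✓p839678 §2 at generic `c`, px13 g29 (RES-u.6) with `γ′ := 2π·τ′·(L⁻¹)^{K−J}`.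
`--kind proof --supports stmt-QuantumFields-20520 --as helper`, count-neutral, DEFINITION-FREE (0 `def`, 0 `instance`, 0 `notation`, 0 `sorry`, default heartbeats).

WHAT IS PROVED (sorry-free).  §3 (generic `P : Params`, private torus bookkeeping): iterated shifts commute with unit shifts, `shiftN x μ 1 = x + e_μ`,
`sitesPerDir 0 = sitesPerDir k · L^k` (`k ≤ m+K`).  ★★★**`exists_lipschitzLift (F : T3Family) {J K : ℕ} (hJK : J ≤ K) (t : Site (F.P J) 0 → SU(2)) {τ : ℝ} (hτ0 : 0 ≤ τ)
(hτ : τ ≤ 1∕8) (hgrad : ∀ B : PBond (F.P J) 0, dist1 (t B.tgt * (t B.src)⁻¹) ≤ τ) : ∃ û : Site (F.P K) 0 → SU(2), descTransf F J K hJK û = t ∧ ∀ b : PBond (F.P K) 0,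
dist1 (û b.tgt * (û b.src)⁻¹) ≤ 2 * π * τ * ((F.L : ℝ)⁻¹) ^ (K - J)`**.  PROOF (all displayed, no `def`): `n := L^{K−J}`, `c₀ := (n−1)∕2`; a fine site `z` has cell
coordinates `w z κ := (z κ − c₀).val = n·(y z κ) + k z κ` (`y z` = the coarse site whose `(K−J)`-fold centre `embIter (K−J) (siteShift x)` — lit ✓`val_embIter`:
coordinate `x·n + c₀` — is the cell's base corner, `k z κ < n` the offset); `û z := I (T (y z)) (k z e₀) (k z e₁) (k z e₂)` with `I` = ✓`exists_cubeInterpolant` (file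
(RES-u.7)₁) and corner data `T y a b c := t (y + a e₀ + b e₁ + c e₂)` (`d = 3`, ✓`T3Family.P_d`).  (i) `û↓ = t`: at a centre all offsets vanish and `I T 0 0 0 = T 0 0 0`
(✓`descTransf_apply`).  (ii) the bond `z → z + e_μ`: either the offset `k z μ` steps inside the cell (`k+1 < n`: the cube's step clause, the twelve edge chords
being coarse bond gradients `≤ τ` by `hgrad`) or it wraps (`k+1 = n`: the next cell's point IS this cell's point at parameter `n` by the UNCONDITIONAL face
identity `I T n k₁ k₂ = I (T(·+1,·,·)) 0 k₁ k₂` and `T (y z) (a+1) b c = T (y z + e₀) a b c`, then the same step clause) — including across the torus seam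
(`ZMod` arithmetic: `(w+1) mod N_K`, `N_K = N_J·n`, lit ✓`sites_eq`).  `2π·τ∕n = 2π·τ·(L⁻¹)^{K−J}`.

HONEST SCOPE.  Finite lattice bookkeeping plus (RES-u.7)₁'s `SU(2)` geometry; `t`, `τ` FREE; the smallness `τ ≤ 1∕8` of the COARSE gradient is a HYPOTHESIS
(in the lane it is w5's §6 output `s′ + σ_V`, itself resting on the conjectured small-bond gauge letter `hBG`@K and row (REG-UP) C — others', displayed there);
the constant `2π` is this proof's, not a quoted one ([Balaban1985RegularSpaces, Lemma 1 p.79, (1.36) p.82; Balaban1985Averaging, (12) p.19] are the printed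
places where gauge transformations are interpolated∕compared between block centres — cited for orientation, not transcribed); nothing of Bałaban's
renormalisation-group analysis is asserted or proved; GAP♯∘ (`stub_uniformFibreGapOrbit`, registry `Lines/semiclassical_s2beta.lean` 3732b7df UNTOUCHED, 0∕5),
S2β, the five registered stubs, crux 20520, 19936, 19200 and `YM3TorusSU2` are NOT proved; no registered stub is closed; rung R3 = SU(2) YM₃ on T³ at fixed
lattice data — NOT d = 4, NOT infinite volume, NOT a mass gap, NOT Clay; the Yang–Mills mass gap is NOT proved.
-/

set_option autoImplicit false

noncomputable section

namespace Summit.QuantumFields.YangMills.Theorems.FluctuationComparisonRegPrIntLS2BetaLipschitzLift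

open scoped Real
open Literature.MathematicalPhysics.QuantumFieldTheory.Balaban1983to89
open T4Continuum T3ContinuumYM3Torus T3LevelShift T3PrintedRegularOrbits
open B15DeterminingSets (embIter)
open B10Eq47AxialChi (shiftN shiftN_zero shiftN_succ)
open B9B8KnitAveragingClosenessAtCorner (val_embIter)
open Summit.QuantumFields.YangMills.Theorems.FluctuationComparisonRegPrIntLS2BetaResidualGaugeRooted (descTransf_apply)
open Summit.QuantumFields.YangMills.Theorems.FluctuationComparisonRegPrIntLS2BetaCubeInterpolant (exists_cubeInterpolant)

/-! ## §3 The torus: cells between the `(K−J)`-fold centres, and the Lipschitz lift -/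

section Torus

variable {P : Params} {j : ℕ}

/-- Shifts in different (or equal) directions commute with iterated shifts. [folklore] -/
private theorem shiftN_shift_comm (x : Site P j) (μ ν : Fin P.d) (a : ℕ) : shiftN (x.shift ν) μ a = (shiftN x μ a).shift ν := by
  funext κ
  by_cases hκν : κ = ν
  · subst hκν
    simp only [BlockAveragingEMLProp2.shiftN_apply, Site.shift_apply, if_true]
    ring
  · simp only [BlockAveragingEMLProp2.shiftN_apply, Site.shift_apply, if_neg hκν]

/-- One more shift in the same direction: `shiftN (x + e_μ) μ a = shiftN x μ (a+1)`. [folklore] -/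
private theorem shiftN_shift_same (x : Site P j) (μ : Fin P.d) (a : ℕ) : shiftN (x.shift μ) μ a = shiftN x μ (a + 1) := by
  rw [shiftN_shift_comm, shiftN_succ]

/-- `shiftN x μ 1 = x + e_μ`. [folklore] -/
private theorem shiftN_one (x : Site P j) (μ : Fin P.d) : shiftN x μ 1 = x.shift μ := by
  rw [shiftN_succ, shiftN_zero]

/-- `sitesPerDir 0 = sitesPerDir k · L^k` in the standing range. [folklore] -/
private theorem sitesPerDir_zero_eq_mul_pow : ∀ {k : ℕ}, k ≤ P.m + P.K → P.sitesPerDir 0 = P.sitesPerDir k * P.L ^ k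
  | 0, _ => by simp
  | k + 1, hk => by
    rw [sitesPerDir_zero_eq_mul_pow (k := k) (by omega), P.sitesPerDir_eq_mul_succ hk, pow_succ]; ring

end Torus

/-- ★★★ **THE LIPSCHITZ LIFT EXISTS** ((RES-u.7); exit (a) of «E_J-FACE»): every coarse gauge transformation `t` on `T_J` with bond gradients `dist1 (t B₊·(t B₋)⁻¹) ≤ τ ≤ 1∕8`
lifts to a fine one `û` on run `K`'s finest lattice with `û↓ = t` (so `û` plugs into ✓`…BodyRebaseLift`'s door exactly like `liftTransfTo t`) and PER-FINE-BOND
gradient `≤ 2π·τ·(L⁻¹)^{K−J}` — the block-constant lift's face jumps `τ` spread evenly over the `L^{K−J}` fine steps between neighbouring centres (§2's cube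
interpolant on every cell of the lattice of centres; cells glue by the face identities).  [cite: Balaban1985RegularSpaces, Lemma 1 p.79, (1.36) p.82; Balaban1985Averaging, (12) p.19] -/
theorem exists_lipschitzLift (F : T3Family) {J K : ℕ} (hJK : J ≤ K)
    (t : Site (F.P J) 0 → Matrix.specialUnitaryGroup (Fin 2) ℂ) {τ : ℝ} (hτ0 : 0 ≤ τ) (hτ : τ ≤ 1 / 8)
    (hgrad : ∀ B : PBond (F.P J) 0, dist1 (t B.tgt * (t B.src)⁻¹) ≤ τ) :
    ∃ û : Site (F.P K) 0 → Matrix.specialUnitaryGroup (Fin 2) ℂ,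
      descTransf F J K hJK û = t ∧
      ∀ b : PBond (F.P K) 0, dist1 (û b.tgt * (û b.src)⁻¹) ≤ 2 * π * τ * ((F.L : ℝ)⁻¹) ^ (K - J) := by
  -- sizes
  set n : ℕ := F.L ^ (K - J) with hn_def
  have hL1 : 1 < F.L := F.hL.2
  have hn : 0 < n := pow_pos (by omega) _
  have hKJ : K - J ≤ (F.P K).m + (F.P K).K := by show K - J ≤ F.m + K; omega
  have hNJ : (F.P J).sitesPerDir 0 = (F.P K).sitesPerDir (K - J) := sites_eq F J K hJK
  have hN : (F.P K).sitesPerDir 0 = (F.P J).sitesPerDir 0 * n := by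
    rw [hNJ]; exact sitesPerDir_zero_eq_mul_pow hKJ
  have hNJpos : 0 < (F.P J).sitesPerDir 0 := Nat.pos_of_ne_zero ((F.P J).sitesPerDir_ne_zero 0)
  -- the three axes on both lattices (`d = 3`)
  have hd : (F.P K).d = 3 := T3Family.P_d F K
  have hdJ : (F.P J).d = 3 := T3Family.P_d F J
  -- the cube interpolant
  obtain ⟨I, hI⟩ := exists_cubeInterpolant hn hτ0 hτ
  -- cell coordinates: `w z κ := (z κ − c₀).val`, block `y z`, offsets `k z`
  set c₀ : ℕ := (n - 1) / 2 with hc₀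
  let w : Site (F.P K) 0 → Fin (F.P K).d → ℕ := fun z κ => (z κ - ((c₀ : ℕ) : ZMod ((F.P K).sitesPerDir 0))).val
  let y : Site (F.P K) 0 → Site (F.P J) 0 := fun z κ' => (((w z (Fin.cast hd.symm (Fin.cast hdJ κ')) / n : ℕ) : ZMod ((F.P J).sitesPerDir 0)))
  let k : Site (F.P K) 0 → Fin (F.P K).d → ℕ := fun z κ => w z κ % n
  let ax : ℕ → Fin (F.P J).d := fun i => ⟨i % 3, by rw [hdJ]; exact Nat.mod_lt _ (by norm_num)⟩
  let T : Site (F.P J) 0 → ℕ → ℕ → ℕ → Matrix.specialUnitaryGroup (Fin 2) ℂ :=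
    fun y₀ a b c => t (shiftN (shiftN (shiftN y₀ (ax 0) a) (ax 1) b) (ax 2) c)
  let axK : ℕ → Fin (F.P K).d := fun i => ⟨i % 3, by rw [hd]; exact Nat.mod_lt _ (by norm_num)⟩
  -- basic facts about the cell coordinates
  have hw_lt : ∀ z κ, w z κ < (F.P K).sitesPerDir 0 := fun z κ => ZMod.val_lt _
  have hk_lt : ∀ z κ, k z κ < n := fun z κ => Nat.mod_lt _ hn
  have hk_le : ∀ z κ, k z κ ≤ n := fun z κ => (hk_lt z κ).le
  have n01 : axK 0 ≠ axK 1 := fun h => absurd (congrArg Fin.val h) (by show ¬ ((0 : ℕ) % 3 = 1 % 3); decide)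
  have n02 : axK 0 ≠ axK 2 := fun h => absurd (congrArg Fin.val h) (by show ¬ ((0 : ℕ) % 3 = 2 % 3); decide)
  have n12 : axK 1 ≠ axK 2 := fun h => absurd (congrArg Fin.val h) (by show ¬ ((1 : ℕ) % 3 = 2 % 3); decide)
  -- the twelve edge chords of every cell are `≤ τ`
  have hT0 : ∀ Y b c, dist1 (T Y 1 b c * (T Y 0 b c)⁻¹) ≤ τ := by
    intro Y b c
    have e1 : shiftN (shiftN (shiftN Y (ax 0) 1) (ax 1) b) (ax 2) c = (shiftN (shiftN Y (ax 1) b) (ax 2) c).shift (ax 0) := by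
      rw [shiftN_one, shiftN_shift_comm, shiftN_shift_comm]
    have e0 : shiftN (shiftN (shiftN Y (ax 0) 0) (ax 1) b) (ax 2) c = shiftN (shiftN Y (ax 1) b) (ax 2) c := by rw [shiftN_zero]
    show dist1 (t _ * (t _)⁻¹) ≤ τ
    rw [e1, e0]
    exact hgrad ⟨shiftN (shiftN Y (ax 1) b) (ax 2) c, ax 0⟩
  have hT1 : ∀ Y a c, dist1 (T Y a 1 c * (T Y a 0 c)⁻¹) ≤ τ := by
    intro Y a c
    have e1 : shiftN (shiftN (shiftN Y (ax 0) a) (ax 1) 1) (ax 2) c = (shiftN (shiftN Y (ax 0) a) (ax 2) c).shift (ax 1) := by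
      rw [shiftN_one, shiftN_shift_comm]
    have e0 : shiftN (shiftN (shiftN Y (ax 0) a) (ax 1) 0) (ax 2) c = shiftN (shiftN Y (ax 0) a) (ax 2) c := by rw [shiftN_zero]
    show dist1 (t _ * (t _)⁻¹) ≤ τ
    rw [e1, e0]
    exact hgrad ⟨shiftN (shiftN Y (ax 0) a) (ax 2) c, ax 1⟩
  have hT2 : ∀ Y a b, dist1 (T Y a b 1 * (T Y a b 0)⁻¹) ≤ τ := by
    intro Y a b
    have e1 : shiftN (shiftN (shiftN Y (ax 0) a) (ax 1) b) (ax 2) 1 = (shiftN (shiftN Y (ax 0) a) (ax 1) b).shift (ax 2) := by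
      rw [shiftN_one]
    have e0 : shiftN (shiftN (shiftN Y (ax 0) a) (ax 1) b) (ax 2) 0 = shiftN (shiftN Y (ax 0) a) (ax 1) b := by rw [shiftN_zero]
    show dist1 (t _ * (t _)⁻¹) ≤ τ
    rw [e1, e0]
    exact hgrad ⟨shiftN (shiftN Y (ax 0) a) (ax 1) b, ax 2⟩
  -- the neighbouring cells' corner data are the shifted corner data
  have hTsh0 : ∀ Y, (fun a b c => T Y (a + 1) b c) = T (Y.shift (ax 0)) := by
    intro Y; funext a b c
    show t _ = t _
    rw [shiftN_shift_same]
  have hTsh1 : ∀ Y, (fun a b c => T Y a (b + 1) c) = T (Y.shift (ax 1)) := by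
    intro Y; funext a b c
    show t _ = t _
    rw [shiftN_shift_comm Y (ax 0) (ax 1), shiftN_shift_same]
  have hTsh2 : ∀ Y, (fun a b c => T Y a b (c + 1)) = T (Y.shift (ax 2)) := by
    intro Y; funext a b c
    show t _ = t _
    rw [shiftN_shift_comm Y (ax 0) (ax 2), shiftN_shift_comm _ (ax 1) (ax 2), shiftN_shift_same]
  refine ⟨fun z => I (T (y z)) (k z (axK 0)) (k z (axK 1)) (k z (axK 2)), ?_, ?_⟩
  · -- the lift restricts to `t` on the centres
    funext x
    rw [descTransf_apply]
    set z₀ : Site (F.P K) 0 := embIter (K - J) (siteShift (sites_eq F J K hJK) x) with hz₀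
    have hval : ∀ κ : Fin (F.P K).d, (z₀ κ).val = (x κ).val * n + c₀ := by
      intro κ
      rw [hz₀, val_embIter hKJ]
      show (coordEquiv (sites_eq F J K hJK) (x κ)).val * F.L ^ (K - J) + (F.L ^ (K - J) - 1) / 2 = _
      rw [coordEquiv_val, ← hn_def, hc₀]
      rfl
    have hxlt : ∀ κ : Fin (F.P K).d, (x κ).val * n < (F.P K).sitesPerDir 0 := by
      intro κ
      rw [hN]
      exact Nat.mul_lt_mul_of_pos_right (ZMod.val_lt (x κ)) hn
    have hw0 : ∀ κ : Fin (F.P K).d, w z₀ κ = (x κ).val * n := by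
      intro κ
      show (z₀ κ - ((c₀ : ℕ) : ZMod ((F.P K).sitesPerDir 0))).val = _
      have hz : z₀ κ = (((x κ).val * n + c₀ : ℕ) : ZMod ((F.P K).sitesPerDir 0)) := by
        rw [← hval κ, ZMod.natCast_zmod_val]
      rw [hz, show ((((x κ).val * n + c₀ : ℕ)) : ZMod ((F.P K).sitesPerDir 0)) - ((c₀ : ℕ) : ZMod ((F.P K).sitesPerDir 0)) =
        (((x κ).val * n : ℕ) : ZMod ((F.P K).sitesPerDir 0)) by push_cast; ring, ZMod.val_natCast, Nat.mod_eq_of_lt (hxlt κ)]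
    have hk0 : ∀ κ : Fin (F.P K).d, k z₀ κ = 0 := by
      intro κ; show w z₀ κ % n = 0; rw [hw0, Nat.mul_mod_left]
    have hy0 : y z₀ = x := by
      funext κ'
      show (((w z₀ (Fin.cast hd.symm (Fin.cast hdJ κ')) / n : ℕ) : ZMod ((F.P J).sitesPerDir 0))) = x κ'
      rw [hw0, Nat.mul_div_cancel _ hn]
      exact ZMod.natCast_zmod_val (x κ')
    show I (T (y z₀)) (k z₀ (axK 0)) (k z₀ (axK 1)) (k z₀ (axK 2)) = t x
    rw [hk0, hk0, hk0, hy0, (hI (T x)).1]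
    show t (shiftN (shiftN (shiftN x (ax 0) 0) (ax 1) 0) (ax 2) 0) = t x
    rw [shiftN_zero, shiftN_zero, shiftN_zero]
  · -- the per-bond gradient
    intro b
    obtain ⟨z, μ⟩ := b
    obtain ⟨i, hi⟩ := μ
    have hi3 : i < 3 := by rw [hd] at hi; exact hi
    have hiJ : i < (F.P J).d := by rw [hdJ]; exact hi3
    have hLn : ((F.L : ℝ)⁻¹) ^ (K - J) = 1 / (n : ℝ) := by rw [hn_def]; push_cast; rw [inv_pow, one_div]
    show dist1 (I (T (y (Site.shift z ⟨i, hi⟩))) (k (Site.shift z ⟨i, hi⟩) (axK 0)) (k (Site.shift z ⟨i, hi⟩) (axK 1)) (k (Site.shift z ⟨i, hi⟩) (axK 2)) *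
      (I (T (y z)) (k z (axK 0)) (k z (axK 1)) (k z (axK 2)))⁻¹) ≤ 2 * π * τ * ((F.L : ℝ)⁻¹) ^ (K - J)
    -- the coordinates of the shifted site
    have hdvd : n ∣ (F.P K).sitesPerDir 0 := ⟨(F.P J).sitesPerDir 0, by rw [hN, mul_comm]⟩
    have hshift_ne : ∀ κ : Fin (F.P K).d, κ ≠ ⟨i, hi⟩ → w (Site.shift z ⟨i, hi⟩) κ = w z κ := by
      intro κ hκ
      show (Site.shift z ⟨i, hi⟩ κ - _).val = (z κ - _).val
      rw [Site.shift_apply, if_neg hκ]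
    have hshift_eq : w (Site.shift z ⟨i, hi⟩) ⟨i, hi⟩ = (w z ⟨i, hi⟩ + 1) % (F.P K).sitesPerDir 0 := by
      show (Site.shift z ⟨i, hi⟩ ⟨i, hi⟩ - ((c₀ : ℕ) : ZMod ((F.P K).sitesPerDir 0))).val =
        ((z ⟨i, hi⟩ - ((c₀ : ℕ) : ZMod ((F.P K).sitesPerDir 0))).val + 1) % (F.P K).sitesPerDir 0
      rw [Site.shift_apply, if_pos rfl, show z ⟨i, hi⟩ + 1 - ((c₀ : ℕ) : ZMod ((F.P K).sitesPerDir 0)) =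
        (z ⟨i, hi⟩ - ((c₀ : ℕ) : ZMod ((F.P K).sitesPerDir 0))) + 1 by ring, ZMod.val_add, ZMod.val_one]
    have hWlt : w z ⟨i, hi⟩ < (F.P K).sitesPerDir 0 := hw_lt _ _
    rcases Nat.lt_or_ge (w z ⟨i, hi⟩ % n + 1) n with hA | hB
    · -- CASE A: the step stays inside the cell
      have hn1 : 1 % n = 1 := Nat.mod_eq_of_lt (by omega)
      have hmodA : (w z ⟨i, hi⟩ + 1) % n = w z ⟨i, hi⟩ % n + 1 := by
        rw [Nat.add_mod, hn1, Nat.mod_eq_of_lt hA]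
      have hnd : ¬ n ∣ w z ⟨i, hi⟩ + 1 := by
        intro h; rw [Nat.mod_eq_zero_of_dvd h] at hmodA; omega
      have hW1lt : w z ⟨i, hi⟩ + 1 < (F.P K).sitesPerDir 0 := by
        rcases Nat.lt_or_ge (w z ⟨i, hi⟩ + 1) ((F.P K).sitesPerDir 0) with h | h
        · exact h
        · exfalso
          have heq : w z ⟨i, hi⟩ + 1 = (F.P K).sitesPerDir 0 := le_antisymm hWlt h
          exact hnd (heq ▸ hdvd)
      have hwA : w (Site.shift z ⟨i, hi⟩) ⟨i, hi⟩ = w z ⟨i, hi⟩ + 1 := by rw [hshift_eq, Nat.mod_eq_of_lt hW1lt]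
      have hyA : y (Site.shift z ⟨i, hi⟩) = y z := by
        funext κ'
        show (((w (Site.shift z ⟨i, hi⟩) (Fin.cast hd.symm (Fin.cast hdJ κ')) / n : ℕ) : ZMod ((F.P J).sitesPerDir 0))) =
          (((w z (Fin.cast hd.symm (Fin.cast hdJ κ')) / n : ℕ) : ZMod ((F.P J).sitesPerDir 0)))
        by_cases hκ : Fin.cast hd.symm (Fin.cast hdJ κ') = ⟨i, hi⟩
        · rw [hκ, hwA, Nat.succ_div_of_not_dvd hnd]
        · rw [hshift_ne _ hκ]
      have hkA : ∀ κ : Fin (F.P K).d, k (Site.shift z ⟨i, hi⟩) κ = if κ = ⟨i, hi⟩ then k z κ + 1 else k z κ := by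
        intro κ
        show w (Site.shift z ⟨i, hi⟩) κ % n = if κ = ⟨i, hi⟩ then w z κ % n + 1 else w z κ % n
        by_cases hκ : κ = ⟨i, hi⟩
        · rw [if_pos hκ, hκ, hwA, hmodA]
        · rw [if_neg hκ, hshift_ne _ hκ]
      interval_cases i
      · -- axis 0, interior step of the cell
        have hμ : (⟨0, hi⟩ : Fin (F.P K).d) = axK 0 := Fin.ext rfl
        have htgt : I (T (y (Site.shift z ⟨0, hi⟩))) (k (Site.shift z ⟨0, hi⟩) (axK 0)) (k (Site.shift z ⟨0, hi⟩) (axK 1)) (k (Site.shift z ⟨0, hi⟩) (axK 2)) =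
            I (T (y z)) (k z (axK 0) + 1) (k z (axK 1)) (k z (axK 2)) := by
          rw [hyA, hkA, hkA, hkA, hμ, if_pos rfl, if_neg n01.symm, if_neg n02.symm]
        rw [htgt, hLn]
        have hstep := ((hI (T (y z))).2.2.2.2 (hT0 _) (hT1 _) (hT2 _) (k z (axK 0)) (k z (axK 1)) (k z (axK 2))
          (hk_le _ _) (hk_le _ _) (hk_le _ _)).1 (by rw [← hμ]; exact hA.le)
        calc _ ≤ 2 * π * τ / n := hstep
          _ = _ := by ring
      · -- axis 1, interior step of the cell
        have hμ : (⟨1, hi⟩ : Fin (F.P K).d) = axK 1 := Fin.ext rfl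
        have htgt : I (T (y (Site.shift z ⟨1, hi⟩))) (k (Site.shift z ⟨1, hi⟩) (axK 0)) (k (Site.shift z ⟨1, hi⟩) (axK 1)) (k (Site.shift z ⟨1, hi⟩) (axK 2)) =
            I (T (y z)) (k z (axK 0)) (k z (axK 1) + 1) (k z (axK 2)) := by
          rw [hyA, hkA, hkA, hkA, hμ, if_neg n01, if_pos rfl, if_neg n12.symm]
        rw [htgt, hLn]
        have hstep := ((hI (T (y z))).2.2.2.2 (hT0 _) (hT1 _) (hT2 _) (k z (axK 0)) (k z (axK 1)) (k z (axK 2))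
          (hk_le _ _) (hk_le _ _) (hk_le _ _)).2.1 (by rw [← hμ]; exact hA.le)
        calc _ ≤ 2 * π * τ / n := hstep
          _ = _ := by ring
      · -- axis 2, interior step of the cell
        have hμ : (⟨2, hi⟩ : Fin (F.P K).d) = axK 2 := Fin.ext rfl
        have htgt : I (T (y (Site.shift z ⟨2, hi⟩))) (k (Site.shift z ⟨2, hi⟩) (axK 0)) (k (Site.shift z ⟨2, hi⟩) (axK 1)) (k (Site.shift z ⟨2, hi⟩) (axK 2)) =
            I (T (y z)) (k z (axK 0)) (k z (axK 1)) (k z (axK 2) + 1) := by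
          rw [hyA, hkA, hkA, hkA, hμ, if_neg n02, if_neg n12, if_pos rfl]
        rw [htgt, hLn]
        have hstep := ((hI (T (y z))).2.2.2.2 (hT0 _) (hT1 _) (hT2 _) (k z (axK 0)) (k z (axK 1)) (k z (axK 2))
          (hk_le _ _) (hk_le _ _) (hk_le _ _)).2.2 (by rw [← hμ]; exact hA.le)
        calc _ ≤ 2 * π * τ / n := hstep
          _ = _ := by ring
    · -- CASE B: the step crosses into the next cell
      have hr : w z ⟨i, hi⟩ % n + 1 = n := le_antisymm (by have := Nat.mod_lt (w z ⟨i, hi⟩) hn; omega) hB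
      have hdv : n ∣ w z ⟨i, hi⟩ + 1 :=
        ⟨w z ⟨i, hi⟩ / n + 1, by have := Nat.div_add_mod (w z ⟨i, hi⟩) n; rw [mul_add, mul_one]; omega⟩
      have hkB : ∀ κ : Fin (F.P K).d, k (Site.shift z ⟨i, hi⟩) κ = if κ = ⟨i, hi⟩ then 0 else k z κ := by
        intro κ
        show w (Site.shift z ⟨i, hi⟩) κ % n = if κ = ⟨i, hi⟩ then 0 else w z κ % n
        by_cases hκ : κ = ⟨i, hi⟩
        · rw [if_pos hκ, hκ, hshift_eq, Nat.mod_mod_of_dvd _ hdvd, Nat.mod_eq_zero_of_dvd hdv]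
        · rw [if_neg hκ, hshift_ne _ hκ]
      have hyB : y (Site.shift z ⟨i, hi⟩) = Site.shift (y z) ⟨i, hiJ⟩ := by
        funext κ'
        rw [Site.shift_apply]
        show (((w (Site.shift z ⟨i, hi⟩) (Fin.cast hd.symm (Fin.cast hdJ κ')) / n : ℕ) : ZMod ((F.P J).sitesPerDir 0))) =
          if κ' = ⟨i, hiJ⟩ then (((w z (Fin.cast hd.symm (Fin.cast hdJ ⟨i, hiJ⟩)) / n : ℕ) : ZMod ((F.P J).sitesPerDir 0))) + 1
          else (((w z (Fin.cast hd.symm (Fin.cast hdJ κ')) / n : ℕ) : ZMod ((F.P J).sitesPerDir 0)))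
        by_cases hκ' : κ' = ⟨i, hiJ⟩
        · rw [if_pos hκ', hκ']
          have hc : Fin.cast hd.symm (Fin.cast hdJ (⟨i, hiJ⟩ : Fin (F.P J).d)) = ⟨i, hi⟩ := Fin.ext rfl
          rw [hc, hshift_eq]
          rcases Nat.lt_or_ge (w z ⟨i, hi⟩ + 1) ((F.P K).sitesPerDir 0) with hlt | hge
          · rw [Nat.mod_eq_of_lt hlt, Nat.succ_div_of_dvd hdv]; push_cast; ring
          · have heq : w z ⟨i, hi⟩ + 1 = (F.P K).sitesPerDir 0 := le_antisymm hWlt hge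
            rw [heq, Nat.mod_self, Nat.zero_div, Nat.cast_zero]
            have h2 : w z ⟨i, hi⟩ / n + 1 = (F.P J).sitesPerDir 0 := by
              have h3 := Nat.succ_div_of_dvd hdv
              rw [heq, hN, Nat.mul_div_cancel _ hn] at h3
              omega
            have h4 : (((w z ⟨i, hi⟩ / n : ℕ) : ZMod ((F.P J).sitesPerDir 0))) + 1 = (((w z ⟨i, hi⟩ / n + 1 : ℕ) : ZMod ((F.P J).sitesPerDir 0))) := by
              push_cast; ring
            rw [h4, h2, ZMod.natCast_self]
        · rw [if_neg hκ']
          have hc : Fin.cast hd.symm (Fin.cast hdJ κ') ≠ ⟨i, hi⟩ := by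
            intro h; apply hκ'; exact Fin.ext (by have := congrArg Fin.val h; simpa using this)
          rw [hshift_ne _ hc]
      interval_cases i
      · -- axis 0, the step INTO the next cell: the face identity
        have hμ : (⟨0, hi⟩ : Fin (F.P K).d) = axK 0 := Fin.ext rfl
        have hμJ : (⟨0, hiJ⟩ : Fin (F.P J).d) = ax 0 := Fin.ext rfl
        have htgt : I (T (y (Site.shift z ⟨0, hi⟩))) (k (Site.shift z ⟨0, hi⟩) (axK 0)) (k (Site.shift z ⟨0, hi⟩) (axK 1)) (k (Site.shift z ⟨0, hi⟩) (axK 2)) =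
            I (T (y z)) n (k z (axK 1)) (k z (axK 2)) := by
          rw [hyB, hkB, hkB, hkB, hμ, hμJ, ← hTsh0 (y z), if_pos rfl, if_neg n01.symm, if_neg n02.symm]
          exact ((hI (T (y z))).2.1 _ _).symm
        rw [htgt, hLn]
        have hkμ : k z (axK 0) + 1 = n := by rw [← hμ]; exact hr
        have hstep := ((hI (T (y z))).2.2.2.2 (hT0 _) (hT1 _) (hT2 _) (k z (axK 0)) (k z (axK 1)) (k z (axK 2))
          (hk_le _ _) (hk_le _ _) (hk_le _ _)).1 hkμ.le
        rw [hkμ] at hstep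
        calc _ ≤ 2 * π * τ / n := hstep
          _ = _ := by ring
      · -- axis 1, the step INTO the next cell: the face identity
        have hμ : (⟨1, hi⟩ : Fin (F.P K).d) = axK 1 := Fin.ext rfl
        have hμJ : (⟨1, hiJ⟩ : Fin (F.P J).d) = ax 1 := Fin.ext rfl
        have htgt : I (T (y (Site.shift z ⟨1, hi⟩))) (k (Site.shift z ⟨1, hi⟩) (axK 0)) (k (Site.shift z ⟨1, hi⟩) (axK 1)) (k (Site.shift z ⟨1, hi⟩) (axK 2)) =
            I (T (y z)) (k z (axK 0)) n (k z (axK 2)) := by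
          rw [hyB, hkB, hkB, hkB, hμ, hμJ, ← hTsh1 (y z), if_neg n01, if_pos rfl, if_neg n12.symm]
          exact ((hI (T (y z))).2.2.1 _ _).symm
        rw [htgt, hLn]
        have hkμ : k z (axK 1) + 1 = n := by rw [← hμ]; exact hr
        have hstep := ((hI (T (y z))).2.2.2.2 (hT0 _) (hT1 _) (hT2 _) (k z (axK 0)) (k z (axK 1)) (k z (axK 2))
          (hk_le _ _) (hk_le _ _) (hk_le _ _)).2.1 hkμ.le
        rw [hkμ] at hstep
        calc _ ≤ 2 * π * τ / n := hstep
          _ = _ := by ring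
      · -- axis 2, the step INTO the next cell: the face identity
        have hμ : (⟨2, hi⟩ : Fin (F.P K).d) = axK 2 := Fin.ext rfl
        have hμJ : (⟨2, hiJ⟩ : Fin (F.P J).d) = ax 2 := Fin.ext rfl
        have htgt : I (T (y (Site.shift z ⟨2, hi⟩))) (k (Site.shift z ⟨2, hi⟩) (axK 0)) (k (Site.shift z ⟨2, hi⟩) (axK 1)) (k (Site.shift z ⟨2, hi⟩) (axK 2)) =
            I (T (y z)) (k z (axK 0)) (k z (axK 1)) n := by
          rw [hyB, hkB, hkB, hkB, hμ, hμJ, ← hTsh2 (y z), if_neg n02, if_neg n12, if_pos rfl]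
          exact ((hI (T (y z))).2.2.2.1 _ _).symm
        rw [htgt, hLn]
        have hkμ : k z (axK 2) + 1 = n := by rw [← hμ]; exact hr
        have hstep := ((hI (T (y z))).2.2.2.2 (hT0 _) (hT1 _) (hT2 _) (k z (axK 0)) (k z (axK 1)) (k z (axK 2))
          (hk_le _ _) (hk_le _ _) (hk_le _ _)).2.2 hkμ.le
        rw [hkμ] at hstep
        calc _ ≤ 2 * π * τ / n := hstep
          _ = _ := by ring

end Summit.QuantumFields.YangMills.Theorems.FluctuationComparisonRegPrIntLS2BetaLipschitzLift

end
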